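/-
Copyright (c) 2026. All rights reserved.
Released under Apache 2.0 license as described in the file LICENSE.
Authors: abc-iut cell — seat abc-iut-L4-t8 (wave 2, L4 discharge; proof-only companion of
abc-iut-L4-t14's `AbsTopIII/RemarksArchimedeanLocal.lean`; consumes abc-iut-L4-t7's
`AutHolomorphicSpacesHolTypeProofs` and abc-iut-L4-t14's `HolomorphicCoresDeckProofs`).
-/
import Literature.AnabelianGeometry.AbsoluteAnabelian.RCHolomorphicInverse
import Literature.AnabelianGeometry.AbsoluteAnabelian.AutHolomorphicSpacesHolTypeProofs
import Literature.AnabelianGeometry.AbsoluteAnabelian.AbsTopIII.RemarksArchimedeanLocal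
import HarnessLib

/-!
# Proof-only companion of `RemarksArchimedeanLocal`: [AbsTopIII] Rmk 2.3.2

S. Mochizuki, *Topics in absolute anabelian geometry III*, Rmk 2.3.2 p.54: "It follows, in
particular, from Corollary 2.3, (ii), that [in the notation of Definition 2.1, (iv)] the notion of a
co-holomorphicization `𝕏 → 𝕐` is, in fact, independent of the choice of the local structures
`𝒰`, `𝒱`." — typed by abc-iut-L4-t14 as the named fact `AbsTopIII.Rmk_2_3_2`
(`RemarksArchimedeanLocal.lean`): a `(𝒰,𝒱)`-local morphism of the Aut-holomorphic spaces of
Riemann surfaces is a `(𝒰',𝒱')`-local morphism for any other local structures.  paraphrase of the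
typing note there: what was missing for a proof is the converse direction — an étale RC-holomorphic
map transports `Aut^hol(U')` onto `Aut^hol(V')` for ALL connected opens — which needs the calculus
of anti-holomorphic maps on Riemann surfaces (conjugating a holomorphic automorphism by an
anti-holomorphic isomorphism is holomorphic).  That calculus is `RCHolomorphicCalculus.lean` /
`RCHolomorphicInverse.lean`; here we prove the CONVERSE OF Cor 2.3 (i),

* `isLocalMorphism_ofCharted_of_isRCHolomorphic` — an étale (`IsLocalHomeomorph`) RC-holomorphic
  map `φ : X → Y` of Riemann surfaces is a `(𝒰,𝒱)`-local morphism `𝕏 → 𝕐` for EVERY pair of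
  local structures: on a connected open `U` mapped homeomorphically onto `V` by `φ`, the
  restriction `e` is RC-holomorphic, hence (abc-iut-L4-t7's `forall_isHolAt_or_forall_isAntiHolAt`)
  holomorphic everywhere or anti-holomorphic everywhere, with inverse of the same type
  (`IsHolAt.symm_apply`, `IsAntiHolAt.symm_apply` — no hypothesis on `e⁻¹`); conjugation by such
  an `e` carries `Aut^hol(U)` onto `Aut^hol(V)` (`anti ∘ hol ∘ anti = hol`);

and deduce the named fact CONDITIONALLY on Cor 2.3 (i) (`LocalMorphismIsRCHolomorphic`, typed in
`AutHolomorphicSpaces.lean`; abc-iut-L4-t7 holds a kernel-clean proof, pending at the gate):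

* `rmk_2_3_2_of_localMorphismIsRCHolomorphic : LocalMorphismIsRCHolomorphic → Rmk_2_3_2`.

Refereed pre-IUT material; nothing here bears on the disputed [IUTchIII] Cor. 3.12; no side taken.
-/

noncomputable section

namespace Literature.AnabelianGeometry.AbsoluteAnabelian

universe u

open _root_.TopologicalSpace _root_.Topology _root_.Set _root_.Metric _root_.Function _root_.Filter
open scoped _root_.Manifold _root_.ContDiff ComplexConjugate

section Restrict

variable {X Y : Type u} [TopologicalSpace X] [ChartedSpace ℂ X] [TopologicalSpace Y]
  [ChartedSpace ℂ Y]

/-- **Restriction to open subsets preserves holomorphy**: if `e : U → V` (opens of Riemann surfaces,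
with their induced charts) is the restriction of `φ : X → Y` and `φ` is holomorphic at `x ∈ U`, then
`e` is holomorphic at `x`. [cite: MochizukiAbsTopIII2015, Definition 2.1 (ii) p.51] -/
theorem IsHolAt.restrict_opens {U : Opens X} {V : Opens Y} {φ : X → Y} {e : U → V}
    (he : ∀ x : U, (e x : Y) = φ x) {x : U} (h : IsHolAt φ (x : X)) : IsHolAt e x := by
  have h' : ∀ᶠ y : U in 𝓝 x, MDifferentiableAt 𝓘(ℂ, ℂ) 𝓘(ℂ, ℂ) φ (y : X) :=
    continuous_subtype_val.continuousAt.eventually h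
  filter_upwards [h'] with y hy
  rw [← mdifferentiableAt_subtypeVal_comp_iff]
  have hfun : (Subtype.val ∘ e) = fun y : U => φ y := funext he
  rw [hfun, mdifferentiableAt_subtype_iff]
  exact hy

/-- **Restriction to open subsets preserves anti-holomorphy**: with `e`, `φ` as above, if `φ` is
anti-holomorphic at `x ∈ U` then so is `e` (the charts of `U`, `V` are the restricted charts of
`X`, `Y`, so the chart expressions agree near the base point).
[cite: MochizukiAbsTopIII2015, Definition 2.1 (ii) p.51] -/
theorem IsAntiHolAt.restrict_opens {U : Opens X} {V : Opens Y} {φ : X → Y} {e : U → V}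
    (he : ∀ x : U, (e x : Y) = φ x) {x : U} (h : IsAntiHolAt φ (x : X)) : IsAntiHolAt e x := by
  have h' : ∀ᶠ y : U in 𝓝 x, ContinuousAt φ (y : X) ∧
      DifferentiableAt ℂ (conj ∘ writtenInExtChartAt 𝓘(ℂ, ℂ) 𝓘(ℂ, ℂ) (y : X) φ)
        (extChartAt 𝓘(ℂ, ℂ) (y : X) y) :=
    continuous_subtype_val.continuousAt.eventually h
  filter_upwards [h'] with y hy
  obtain ⟨hc, hd⟩ := hy
  have hfun : (Subtype.val ∘ e) = φ ∘ Subtype.val := funext he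
  refine ⟨?_, ?_⟩
  · have h1 : ContinuousAt (fun z : U => φ (z : X)) y := hc.comp continuous_subtype_val.continuousAt
    have h2 : (fun z : U => ((e z : V) : Y)) = fun z : U => φ (z : X) := funext he
    rw [Topology.IsInducing.subtypeVal.continuousAt_iff]
    show ContinuousAt (fun z : U => ((e z : V) : Y)) y
    rw [h2]
    exact h1
  · -- the chart expressions of `e` at `y` and of `φ` at `y.1` agree near the base point
    set cX := chartAt ℂ (y : X) with hcX
    set cY := chartAt ℂ (φ y) with hcY
    have hpt : extChartAt 𝓘(ℂ, ℂ) y y = cX y := by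
      rw [extChartAt_apply_eq, hcX]
      rfl
    have hpt' : extChartAt 𝓘(ℂ, ℂ) (y : X) y = cX y := by simp [hcX]
    have hW : ∀ w, writtenInExtChartAt 𝓘(ℂ, ℂ) 𝓘(ℂ, ℂ) (y : X) φ w = cY (φ (cX.symm w)) :=
        fun w => by
      simp [writtenInExtChartAt, hcX, hcY]
    have hWe : ∀ w, writtenInExtChartAt 𝓘(ℂ, ℂ) 𝓘(ℂ, ℂ) y e w =
        chartAt ℂ ((e y : V) : Y) (((e ((chartAt ℂ y).symm w)) : V) : Y) := fun w => by
      rw [writtenInExtChartAt_apply_eq]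
      rfl
    have hey : ((e y : V) : Y) = φ y := he y
    have hev : writtenInExtChartAt 𝓘(ℂ, ℂ) 𝓘(ℂ, ℂ) y e =ᶠ[𝓝 (cX y)]
        writtenInExtChartAt 𝓘(ℂ, ℂ) 𝓘(ℂ, ℂ) (y : X) φ := by
      have hsymm := TopologicalSpace.Opens.chartAt_subtype_val_symm_eventuallyEq (H := ℂ) U (x := y)
      -- hsymm : cX.symm =ᶠ[𝓝 (cX y)] Subtype.val ∘ (chartAt ℂ y).symm
      filter_upwards [hsymm] with w hw
      rw [hWe, hW, hey, hcY, hcX, he]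
      congr 2
      rw [hw]
      rfl
    rw [hpt]
    rw [hpt'] at hd
    exact ((hev.fun_comp conj).differentiableAt_iff).2 hd

/-- Restriction of an RC-holomorphic map to open subsets is RC-holomorphic.
[cite: MochizukiAbsTopIII2015, Definition 2.1 (ii) p.51] -/
theorem IsRCHolomorphic.restrict_opens {U : Opens X} {V : Opens Y} {φ : X → Y} {e : U → V}
    (he : ∀ x : U, (e x : Y) = φ x) (h : IsRCHolomorphic φ) : IsRCHolomorphic e := fun x =>
  (h (x : X)).imp (IsHolAt.restrict_opens he) (IsAntiHolAt.restrict_opens he)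

end Restrict

section Transport

variable {M N : Type u} [TopologicalSpace M] [ChartedSpace ℂ M] [IsManifold 𝓘(ℂ, ℂ) ω M]
  [TopologicalSpace N] [ChartedSpace ℂ N] [IsManifold 𝓘(ℂ, ℂ) ω N]

/-- **Conjugation by a homeomorphism of Riemann surfaces of constant type preserves holomorphy.**
If `e : M ≃ₜ N` is holomorphic at every point or anti-holomorphic at every point, then for every
holomorphic `ψ : M → M` the conjugate `e ∘ ψ ∘ e⁻¹` is holomorphic (`hol ∘ hol ∘ hol` resp.
`anti ∘ hol ∘ anti`, the inverse having the same type unconditionally).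
[cite: MochizukiAbsTopIII2015, Remark 2.3.2 p.54] -/
theorem mdifferentiable_conj_of_constantType (e : M ≃ₜ N)
    (htype : (∀ x, IsHolAt (⇑e) x) ∨ (∀ x, IsAntiHolAt (⇑e) x)) {ψ : M → M}
    (hψ : MDifferentiable 𝓘(ℂ, ℂ) 𝓘(ℂ, ℂ) ψ) :
    MDifferentiable 𝓘(ℂ, ℂ) 𝓘(ℂ, ℂ) (⇑e ∘ ψ ∘ ⇑e.symm) := by
  intro v
  have hψhol : ∀ u : M, IsHolAt ψ u := fun u => Filter.Eventually.of_forall fun w => hψ w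
  rcases htype with hh | ha
  · -- holomorphic type
    have h1 : IsHolAt (⇑e.symm) v := by
      have := (hh (e.symm v)).symm_apply e
      rwa [e.apply_symm_apply] at this
    have h2 : IsHolAt (ψ ∘ ⇑e.symm) v := (hψhol _).comp h1
    have h3 : IsHolAt (⇑e ∘ ψ ∘ ⇑e.symm) v := (hh _).comp h2
    exact h3.mdifferentiableAt
  · -- anti-holomorphic type
    have h1 : IsAntiHolAt (⇑e.symm) v := by
      have := (ha (e.symm v)).symm_apply e
      rwa [e.apply_symm_apply] at this
    have h2 : IsAntiHolAt (ψ ∘ ⇑e.symm) v := (hψhol _).comp_isAntiHolAt h1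
    have h3 : IsHolAt (⇑e ∘ ψ ∘ ⇑e.symm) v := (ha _).comp_isAntiHolAt h2
    exact h3.mdifferentiableAt

/-- **Transport of `Aut^hol` along a homeomorphism of constant type.**  For `e : U ≃ₜ V` between
open subsets of Riemann surfaces which is everywhere holomorphic or everywhere anti-holomorphic,
conjugation by `e` carries `Aut^hol(U)` onto `Aut^hol(V)`.
[cite: MochizukiAbsTopIII2015, Remark 2.3.2 p.54] -/
theorem holAut_map_homeoConj_of_constantType {X Y : Type u} [TopologicalSpace X] [ChartedSpace ℂ X]
    [IsManifold 𝓘(ℂ, ℂ) ω X] [TopologicalSpace Y] [ChartedSpace ℂ Y] [IsManifold 𝓘(ℂ, ℂ) ω Y]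
    {U : Opens X} {V : Opens Y} (e : U ≃ₜ V)
    (htype : (∀ x, IsHolAt (⇑e) x) ∨ (∀ x, IsAntiHolAt (⇑e) x)) :
    (holAut U).map (homeoConj e).toMonoidHom = holAut V := by
  have htype' : (∀ y, IsHolAt (⇑e.symm) y) ∨ (∀ y, IsAntiHolAt (⇑e.symm) y) := by
    rcases htype with hh | ha
    · left
      intro y
      have := (hh (e.symm y)).symm_apply e
      rwa [e.apply_symm_apply] at this
    · right
      intro y
      have := (ha (e.symm y)).symm_apply e
      rwa [e.apply_symm_apply] at this
  ext χ
  rw [Subgroup.mem_map_equiv]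
  simp only [mem_holAut_iff]
  constructor
  · rintro ⟨h1, h2⟩
    refine ⟨?_, ?_⟩
    · have : ⇑χ = ⇑e ∘ ⇑((homeoConj e).symm χ) ∘ ⇑e.symm := by
        ext y; simp [homeoConj]
      rw [this]
      exact mdifferentiable_conj_of_constantType e htype h1
    · have : ⇑χ.symm = ⇑e ∘ ⇑((homeoConj e).symm χ).symm ∘ ⇑e.symm := by
        ext y; simp [homeoConj]
      rw [this]
      exact mdifferentiable_conj_of_constantType e htype h2
  · rintro ⟨h1, h2⟩
    refine ⟨?_, ?_⟩
    · have : ⇑((homeoConj e).symm χ) = ⇑e.symm ∘ ⇑χ ∘ ⇑e.symm.symm := by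
        ext y; simp [homeoConj]
      rw [this]
      exact mdifferentiable_conj_of_constantType e.symm htype' h1
    · have : ⇑((homeoConj e).symm χ).symm = ⇑e.symm ∘ ⇑χ.symm ∘ ⇑e.symm.symm := by
        ext y; simp [homeoConj]
      rw [this]
      exact mdifferentiable_conj_of_constantType e.symm htype' h2

end Transport

section Converse

variable {X Y : Type u} [TopologicalSpace X] [T2Space X] [ChartedSpace ℂ X] [IsManifold 𝓘(ℂ, ℂ) ω X]
  [TopologicalSpace Y] [T2Space Y] [ChartedSpace ℂ Y] [IsManifold 𝓘(ℂ, ℂ) ω Y]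

omit [T2Space X] [T2Space Y] in
/-- **Converse of [AbsTopIII] Cor 2.3 (i).**  An étale RC-holomorphic map `φ : X → Y` of Riemann
surfaces is a `(𝒰,𝒱)`-local morphism of the associated Aut-holomorphic spaces for EVERY pair of
collections `𝒰`, `𝒱`: whenever `φ` maps a connected open `U` homeomorphically onto `V`, the
restriction is RC-holomorphic, hence of constant type on the connected `U`, and conjugation by it
carries `Aut^hol(U)` onto `Aut^hol(V)`. [cite: MochizukiAbsTopIII2015, Remark 2.3.2 p.54] -/
theorem isLocalMorphism_ofCharted_of_isRCHolomorphic {φ : X → Y} (hφ : IsLocalHomeomorph φ)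
    (hrc : IsRCHolomorphic φ) (𝒰 : Set (Opens X)) (𝒱 : Set (Opens Y)) :
    IsLocalMorphism (AutHolStructure.ofCharted X) (AutHolStructure.ofCharted Y) 𝒰 𝒱 φ := by
  refine ⟨hφ, ?_⟩
  intro U V _ _ e he
  rw [AutHolStructure.ofCharted_aut, AutHolStructure.ofCharted_aut]
  have hrce : IsRCHolomorphic (⇑e) := hrc.restrict_opens he
  haveI : PreconnectedSpace U.1 := Subtype.preconnectedSpace U.2.isPreconnected
  have htype : (∀ x, IsHolAt (⇑e) x) ∨ (∀ x, IsAntiHolAt (⇑e) x) := by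
    rcases forall_isHolAt_or_forall_isAntiHolAt e hrce isPreconnected_univ with h | h
    · exact Or.inl fun x => h x (mem_univ x)
    · exact Or.inr fun x => h x (mem_univ x)
  exact holAut_map_homeoConj_of_constantType e htype

/-- **[AbsTopIII] Rmk 2.3.2, conditionally on Cor 2.3 (i).**  Granting the named fact
`LocalMorphismIsRCHolomorphic` (Cor 2.3 (i): local morphisms of Aut-holomorphic spaces of Riemann
surfaces are RC-holomorphic — a kernel proof by abc-iut-L4-t7 is pending at the gate), the named
fact `AbsTopIII.Rmk_2_3_2` of `RemarksArchimedeanLocal.lean` holds: a `(𝒰,𝒱)`-local morphism is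
RC-holomorphic and étale, hence (`isLocalMorphism_ofCharted_of_isRCHolomorphic`) a `(𝒰',𝒱')`-local
morphism for any local structures `𝒰'`, `𝒱'`.
[cite: MochizukiAbsTopIII2015, Remark 2.3.2 p.54] -/
theorem rmk_2_3_2_of_localMorphismIsRCHolomorphic (h : LocalMorphismIsRCHolomorphic) :
    AbsTopIII.Rmk_2_3_2 := by
  intro X Y _ _ _ _ _ _ _ _ 𝒰 𝒰' 𝒱 𝒱' h𝒰 _ h𝒱 _ φ hφ
  exact isLocalMorphism_ofCharted_of_isRCHolomorphic hφ.isLocalHomeomorph (h X Y 𝒰 𝒱 h𝒰 h𝒱 φ hφ)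
    𝒰' 𝒱'

end Converse

end Literature.AnabelianGeometry.AbsoluteAnabelian
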